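import Summits.ABC.IUTFork.Cor312VolumesRealArch
import Summits.ABC.IUTFork.Cor312SettingDHVol
import Summits.ABC.IUTFork.Cor312HullFrameArch
import HarnessLib

/-!
# [IUTchIII] Corollary 3.12, statement — the `Cor312.Setting` over the REAL log-shells with the verbatim volumes
# AND AN HONEST ARCHIMEDEAN PLACE: `hadm` and `hul_nonempty` PROVED, `BridgeHyps` down to the named residuals

Record-only file (D-0012) of the abc-iut cell (wave-5 prover seat abc-iut-w5-d163 gen 2; TEAM A row A-0 NAMED
LEFTOVER (4) «archimedean radial container vs DH convention»); TAKES NO SIDE on [IUTchIII] Cor. 3.12.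
abc-iut-c312-5's `Cor312SettingDHVol` assembles the setting of the printed statement of [IUTchIII] Cor. 3.12
(kurims `paper:url-4b091feeb646` p. 173 l. 41 – p. 174 l. 19) over `Real.situationDHVol` by c312-7's
`Setting.ofComparison`, with NO field factor at `v_ℚ = ∞` (the trivial archimedean container). Over the situation
`Real.situationDHVolArch` of `Cor312VolumesRealArch` — the SAME real log-shells with the verbatim container made
honest at `∞` (the real archimedean packet `M_I` of [IUTchIV] Prop. 1.5 (iii) with L5-t7's normalised packet
log-volume) — admissibility at `∞` is "positive finite volume", so the setting must carry GENUINE field factors at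
`∞`: the `2^{j}·|V(F)_∞|^{j+1}` copies of `ℂ` of the canonical decomposition `Φ₀ : M_I ≅ ⊕_{(w,ε)} ℂ` ([IUTchIV]
Prop. 1.5 (iii); [IUTchIII] Prop. 3.1 (i)), compared by `Φ₀ ∘ e`, with the ARCHIMEDEAN hull frame
`HullFrame.ofNormSurjective` of c312-7's `Cor312HullFrameArch` (hull-sets `λ·𝒪_L` = polydiscs; `ℂ` is not
ultrametric, so the per-frame assembler `Setting.ofFrames` is used, not `ofComparison`). THIS file:

* `Real.factorIdxDHArch` / `factorFieldDHArch` / `factorMapDHArch` / `frameKDHArch` — c312-5's field-factor pieces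
  at the primes (`PadicPresentation.factorIdx/factorField/factorMap`, `HullFrame.ofLocalFields`) and the copies of
  `ℂ` at `∞`; `Real.realFramesDHArch : Setting.RealFrames (situationDHVolArch …)`;
* **`Real.hadm_DHArch`** — hull-sets are ADMISSIBLE at every place: at a prime by c312-5's
  `adm_preimage_of_isHullSet`, at `∞` because `(Φ₀ ∘ e)⁻¹(λ·𝒪_L)` is the pull-back of the polydisc of radii
  `‖λ_idx‖ > 0`, of positive finite volume (`ArchPresentation.adm_preimage_polydisc`, [IUTchIII] Rmk. 3.9.5 (ii)
  "`λ·𝒪 ∈ 𝕄(𝓘^ℚ(−))`");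
* **`Real.settingDHVolArch`** := `Setting.ofFrames …` — binders left EXACTLY as in c312-5's `settingDHVol`
  (column `n`, context `lat`/`sig`/`split`/`qData`, Θ-boxes, `q`-centre with `hq`, `hfin`) plus "`√−1 ∈ F`";
  `hul_nonempty_settingDHVolArch`; **`bridgeHyps_settingDHVolArch`** — c312-6's `BridgeHyps` with `mono`,
  `image_adm`, `image_fin`, `hul_nonempty`, `theta_nonempty` DISCHARGED and the SAME three named residuals
  (`hθ`, `hfinθ`, `ThetaFinite`) — where now `hθ` at `∞` asks for a Θ-box of positive finite volume (e.g. the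
  Step (vii) container `π^{j+1}·B_I`: `Real.adm_thetaContainer_arch`, log-volume `(j+1)·log π`).
[claim: Mochizuki2012, status: disputed] for the quoted setting; [cite: DupuyHilado2025, Def. 3.6.1] at finite `p`;
[cite: Mochizuki2012, IUTchIV Prop. 1.5 (iii) p. 15] at `∞`. Deliberately NOT here: Θ-boxes, `IsSettingOf`
(c312-8), `HullDefined`/`ThetaFinite` at the real setting (c312-5 `Cor312HullDefinedDHVol`/`…ThetaFiniteDHVol`
lineage — their `∞`-clauses become "bounded + nondegenerate image in `⊕_{(w,ε)} ℂ`" here), any judgement.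
-/

noncomputable section

open Set Function NumberField IsDedekindDomain
open scoped Pointwise

namespace Summit.ABC

namespace IUTFork

namespace Thm311

namespace Real

open Cor312 Cor312Vol Literature.IUT.LogThetaLattice Literature.IUT.LogVolume Literature.IUT.LogVolume.Prop15iii

variable {F : Type} [Field F] [NumberField F] (X : PilotData F) {logv : PadicLogs F} (hlog : LogvAnalytic logv)
  (hc : ∀ w : InfinitePlace F, w.IsComplex)

/-! ## The field-factor pieces at every place, archimedean place honest -/

/-- Field-factor index per `(j, v_ℚ)`: `Σ_{v⃗} DIdx` at a prime (c312-5; [IUTchIV] Prop. 1.4 (i)), and at `∞` the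
index `V(F)_∞^{S^±_{j+1}} × {±}^{S^±_{j+1} ∖ {i₀}}` of the copies of `ℂ` in the canonical decomposition of `M_I`
(L5-t7 `Idx`; [IUTchIV] Prop. 1.5 (iii) "`2^{|I|−1}·|V|^{|I|}` copies of `ℂ`"). [cite: Mochizuki2012, IUTchIV Prop. 1.5 (iii) p. 15] -/
def factorIdxDHArch : ∀ (j : (thetaIndex X).Label) (vQ : (thetaIndex X).VQ), Type
  | j, .inl _ => ArchPresentation.J (T := thetaIndex X) (Sum.inl ()) j
  | j, .inr pp => haveI : Fact (pp : ℕ).Prime := ⟨pp.2⟩; (presAt X hlog pp).factorIdx j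

/-- … is finite. [folklore] -/
@[reducible] def factorIdxDHArch_fintype :
    ∀ (j : (thetaIndex X).Label) (vQ : (thetaIndex X).VQ), Fintype (factorIdxDHArch X hlog j vQ)
  | j, .inl _ => by
    letI := ArchPresentation.fibreFintype (T := thetaIndex X) (Sum.inl ())
    exact inferInstanceAs (Fintype (ArchPresentation.J (T := thetaIndex X) (Sum.inl ()) j))
  | j, .inr pp => factorIdxDH_fintype X hlog j (.inr pp)

/-- The field factors: c312-3's `DFac` at a prime, `ℂ` at `∞`. [cite: Mochizuki2012, IUTchIV Prop. 1.5 (iii) p. 15] -/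
def factorFieldDHArch :
    ∀ (j : (thetaIndex X).Label) (vQ : (thetaIndex X).VQ), factorIdxDHArch X hlog j vQ → Type
  | _, .inl _ => fun _ => ℂ
  | j, .inr pp => haveI : Fact (pp : ℕ).Prime := ⟨pp.2⟩; fun s => (presAt X hlog pp).factorField j s

/-- … are nontrivially normed fields. [folklore] -/
@[reducible] def factorFieldDHArch_field : ∀ (j : (thetaIndex X).Label) (vQ : (thetaIndex X).VQ)
    (s : factorIdxDHArch X hlog j vQ), NontriviallyNormedField (factorFieldDHArch X hlog j vQ s)
  | _, .inl _, _ => inferInstanceAs (NontriviallyNormedField ℂ)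
  | j, .inr pp, s => factorFieldDH_field X hlog j (.inr pp) s

attribute [instance] factorIdxDHArch_fintype factorFieldDHArch_field

/-- At a prime the factors are ultrametric (c312-3 `isUltrametricDist_dFac`). [folklore] -/
theorem factorFieldDHArch_ultra (j : (thetaIndex X).Label) (pp : Nat.Primes)
    (s : factorIdxDHArch X hlog j (.inr pp)) : IsUltrametricDist (factorFieldDHArch X hlog j (.inr pp) s) :=
  factorFieldDH_ultra X hlog j (.inr pp) s

/-- At a prime the factors are proper (c312-3 `properSpace_dFac`). [folklore] -/
theorem factorFieldDHArch_proper (j : (thetaIndex X).Label) (pp : Nat.Primes)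
    (s : factorIdxDHArch X hlog j (.inr pp)) : ProperSpace (factorFieldDHArch X hlog j (.inr pp) s) :=
  factorFieldDH_proper X hlog j (.inr pp) s

attribute [instance] factorFieldDHArch_ultra factorFieldDHArch_proper

/-- The field-factor comparison: c312-5's `factorMap` at a prime; `Φ₀ ∘ e` at `∞` (L5-t7's canonical decomposition
after the archimedean comparison of `Cor312VolumesArchSummands`). [claim: Mochizuki2012, status: disputed] -/
def factorMapDHArch : ∀ (j : (thetaIndex X).Label) (vQ : (thetaIndex X).VQ),
    (logShellsDH X logv).Packet j vQ → ∀ s : factorIdxDHArch X hlog j vQ, factorFieldDHArch X hlog j vQ s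
  | j, .inl _ => fun x s =>
    ArchPresentation.Φ₀ (T := thetaIndex X) (Sum.inl ()) j ((archPresentationDH X logv hc).comparison j x) s
  | j, .inr pp => haveI : Fact (pp : ℕ).Prime := ⟨pp.2⟩; fun x s => (presAt X hlog pp).factorMap j x s

/-- The hull frame of each real packet: c312-7's `HullFrame.ofLocalFields` at a prime, the ARCHIMEDEAN frame
`HullFrame.ofNormSurjective` (copies of `ℂ` are norm-surjective) at `∞`. [claim: Mochizuki2012, status: disputed] -/
def frameKDHArch : ∀ (j : (thetaIndex X).Label) (vQ : (thetaIndex X).VQ),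
    HullFrame (∀ s : factorIdxDHArch X hlog j vQ, factorFieldDHArch X hlog j vQ s)
  | j, .inl _ => HullFrame.ofNormSurjective (factorFieldDHArch X hlog j (.inl ()))
      (HullFrame.normSurjective_of_rclike ℂ _)
  | j, .inr pp => HullFrame.ofLocalFields (factorFieldDHArch X hlog j (.inr pp))

/-- The frames' hull-sets are exactly S2's `λ·𝒪_L`. [folklore] -/
theorem frameKDHArch_hul_iff : ∀ (j : (thetaIndex X).Label) (vQ : (thetaIndex X).VQ)
    (H : Set (∀ s : factorIdxDHArch X hlog j vQ, factorFieldDHArch X hlog j vQ s)),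
    H ∈ (frameKDHArch X hlog j vQ).Hul ↔ IsHullSet (factorFieldDHArch X hlog j vQ) H
  | _, .inl _, _ => Iff.rfl
  | _, .inr _, _ => Iff.rfl

section Setting

variable (M : Type) [Field M] [NumberField M]
  (archPk : ∀ (j : (thetaIndex X).Label) (vQ : (thetaIndex X).VQ), Set ((logShellsDH X logv).Packet j vQ))
  (archSub : ∀ (j : (thetaIndex X).Label) (v : (thetaIndex X).V),
    Set ((logShellsDH X logv).Packet j ((thetaIndex X).over v)))
  (Ψ : ℤ → ∀ v : (thetaIndex X).V, v ∈ (thetaIndex X).Vbad → Set ((logShellsDH X logv).StarPacket v))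
  (act : ℤ → ∀ v : (thetaIndex X).V, v ∈ (thetaIndex X).Vbad →
    (logShellsDH X logv).StarPacket v → Module.End ℚ ((logShellsDH X logv).StarPacket v))
  (Mmod : ℤ → ∀ j : (thetaIndex X).LabelStar, Set ((logShellsDH X logv).GlobalPacket j.1))
  (region : ℤ → ∀ j : (thetaIndex X).LabelStar, FinDivisor M → ∀ vQ : (thetaIndex X).VQ,
    Set ((logShellsDH X logv).Packet j.1 vQ))

/-- **The real field-factor frames** of the setting over `Real.situationDHVolArch`: factors, comparison, frames,
and the two pilot binders (Θ-boxes, `q`-centre). [claim: Mochizuki2012, status: disputed] -/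
def realFramesDHArch {ObLgp ObΔ : Type}
    (thetaBox : ℤ → ObLgp → ∀ (j : (thetaIndex X).Label) (vQ : (thetaIndex X).VQ),
      Set (∀ s : factorIdxDHArch X hlog j vQ, factorFieldDHArch X hlog j vQ s))
    (qCentre : ObΔ → ∀ (j : (thetaIndex X).Label) (vQ : (thetaIndex X).VQ),
      ∀ s : factorIdxDHArch X hlog j vQ, factorFieldDHArch X hlog j vQ s) :
    Setting.RealFrames (situationDHVolArch X hlog hc M archPk archSub Ψ act Mmod region) ObLgp ObΔ where
  J := factorIdxDHArch X hlog
  instFintype := factorIdxDHArch_fintype X hlog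
  K := factorFieldDHArch X hlog
  instField := factorFieldDHArch_field X hlog
  e := factorMapDHArch X hlog hc
  frameK := frameKDHArch X hlog
  hul_iff := frameKDHArch_hul_iff X hlog
  thetaBox := thetaBox
  qCentre := qCentre

/-- At `∞`, the pull-back of a hull-set `λ·𝒪_L` under `Φ₀ ∘ e` is the pull-back under `e` of the pull-back under
`Φ₀` of the polydisc of radii `‖λ_idx‖`. [folklore] -/
theorem factorMapDHArch_preimage_hullSet_inl (j : (thetaIndex X).Label)
    (c : ∀ s : factorIdxDHArch X hlog j (.inl ()), factorFieldDHArch X hlog j (.inl ()) s) :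
    factorMapDHArch X hlog hc j (.inl ()) ⁻¹' hullSet (factorFieldDHArch X hlog j (.inl ())) c =
      (archPresentationDH X logv hc).comparison j ⁻¹'
        ((ArchPresentation.Φ₀ (T := thetaIndex X) (Sum.inl ()) j :
            ArchPresentation.X (T := thetaIndex X) (Sum.inl ()) j →
              (ArchPresentation.J (T := thetaIndex X) (Sum.inl ()) j → ℂ)) ⁻¹'
          ArchPacket.polydisc (ArchPresentation.J (T := thetaIndex X) (Sum.inl ()) j) fun s => ‖c s‖) := by
  ext x
  simp only [Set.mem_preimage, hullSet, mem_polydisc, ArchPacket.polydisc, Set.mem_setOf_eq]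
  rfl

/-- **`hadm` DISCHARGED for the real log-shells with the verbatim volumes, archimedean place honest**: the preimage
of every hull-set `λ·𝒪_L` of every real packet is an admissible region of every line of `situationDHVolArch`
([IUTchIII] Rmk. 3.9.5 (ii) "`λ·𝒪 ∈ 𝕄(𝓘^ℚ(−))`": at a prime by c312-5's `adm_preimage_of_isHullSet`; at `∞` the
polydisc of positive radii has positive finite volume, `ArchPresentation.adm_preimage_polydisc`).
[claim: Mochizuki2012, status: disputed] -/
theorem hadm_DHArch (n : ℤ) : ∀ (j : (thetaIndex X).Label) (vQ : (thetaIndex X).VQ)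
    (H : Set (∀ s : factorIdxDHArch X hlog j vQ, factorFieldDHArch X hlog j vQ s)),
    IsHullSet (factorFieldDHArch X hlog j vQ) H →
      ((situationDHVolArch X hlog hc M archPk archSub Ψ act Mmod region).D n).Adm j vQ
        (factorMapDHArch X hlog hc j vQ ⁻¹' H)
  | j, .inl u, H, hH => by
    cases u
    obtain ⟨c, hc0, rfl⟩ := hH
    show (archPresentationDH X logv hc).toLocalPieces.Adm j
      (factorMapDHArch X hlog hc j (.inl ()) ⁻¹' hullSet (factorFieldDHArch X hlog j (.inl ())) c)
    rw [factorMapDHArch_preimage_hullSet_inl]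
    exact (archPresentationDH X logv hc).adm_preimage_of_adm j
      (ArchPresentation.adm_preimage_polydisc j fun s => norm_pos_iff.mpr (hc0 s))
  | j, .inr pp, H, hH => by
    haveI : Fact (pp : ℕ).Prime := ⟨pp.2⟩
    exact (presAt X hlog pp).adm_preimage_of_isHullSet j hH

variable (n : ℤ) {HT : Type} {LogLink : HT → HT → Type} {IsFull : ∀ {s t : HT}, LogLink s t → Prop}
  (lat : LGPGaussianLogThetaLattice LogLink IsFull)
  {Frd : Type} {IsoF : Frd → Frd → Type} {Ob : Frd → Type} {realify : Frd → Frd} {Strip : Type}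
  {IsoS : Strip → Strip → Type} {Mv : ∀ v : (thetaIndex X).V, v ∈ (thetaIndex X).Vbad → Type}
  [∀ v h, Monoid (Mv v h)]
  (sig : GlobalLGPFrobenioidSignature (thetaIndex X).lstar (thetaIndex X).V (· ∈ (thetaIndex X).Vbad)
    Frd IsoF Ob realify Strip IsoS Mv)
  (split : SplittingMonoids Mv) {ObΔ : Type} {N : ∀ v : (thetaIndex X).V, v ∈ (thetaIndex X).Vbad → Type}
  [∀ v h, Monoid (N v h)] (qData : QPilotData ObΔ N)
  (thetaBox : ℤ → Ob sig.Clgp → ∀ (j : (thetaIndex X).Label) (vQ : (thetaIndex X).VQ),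
    Set (∀ s : factorIdxDHArch X hlog j vQ, factorFieldDHArch X hlog j vQ s))
  (qCentre : ObΔ → ∀ (j : (thetaIndex X).Label) (vQ : (thetaIndex X).VQ),
    ∀ s : factorIdxDHArch X hlog j vQ, factorFieldDHArch X hlog j vQ s)
  (hq : ∀ j vQ s, qCentre (qPilotObject qData) j vQ s ≠ 0)
  (hfin : ∀ j : (thetaIndex X).Label, (Function.support fun vQ =>
    ((situationDHVolArch X hlog hc M archPk archSub Ψ act Mmod region).D n).logvol j vQ
      (factorMapDHArch X hlog hc j vQ ⁻¹' hullSet (factorFieldDHArch X hlog j vQ) (qCentre (qPilotObject qData) j vQ))).Finite)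

/-- **The setting of [IUTchIII] Cor. 3.12 over the REAL log-shells of `F` with the VERBATIM volumes and an HONEST
archimedean place** (c312-7's per-frame assembler `Setting.ofFrames` at `Real.situationDHVolArch` with the real
field-factor frames; `hadm` PROVED). Binders left as in c312-5's `settingDHVol` plus "`√−1 ∈ F`".
[claim: Mochizuki2012, status: disputed] -/
def settingDHVolArch : Cor312.Setting (situationDHVolArch X hlog hc M archPk archSub Ψ act Mmod region) :=
  Setting.ofFrames n lat sig split qData
    (realFramesDHArch X hlog hc M archPk archSub Ψ act Mmod region thetaBox qCentre)
    hq (hadm_DHArch X hlog hc M archPk archSub Ψ act Mmod region n) hfin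

/-- The column of the assembled setting is `n`. [folklore] -/
theorem settingDHVolArch_n :
    (settingDHVolArch X hlog hc M archPk archSub Ψ act Mmod region n lat sig split qData thetaBox qCentre hq
      hfin).n = n :=
  rfl

/-- **`hul_nonempty` DISCHARGED**: every hull-set of every frame of the assembled setting is nonempty (it is an
admissible region of the verbatim container). [folklore] -/
theorem hul_nonempty_settingDHVolArch (j : (thetaIndex X).Label) (vQ : (thetaIndex X).VQ) :
    ∀ H ∈ ((settingDHVolArch X hlog hc M archPk archSub Ψ act Mmod region n lat sig split qData thetaBox qCentre hq
      hfin).frame j vQ).Hul, H.Nonempty := by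
  rintro _ ⟨H', hH', rfl⟩
  have h := hadm_DHArch X hlog hc M archPk archSub Ψ act Mmod region n j vQ H'
    ((frameKDHArch_hul_iff X hlog j vQ H').mp hH')
  exact SummandPieces.Adm.nonempty ((realizes_situationDHVolArch X hlog hc M archPk archSub Ψ act Mmod region
    n).adm_iff j vQ _ |>.1 h)

/-- **c312-6's `BridgeHyps` for the real setting with the verbatim volumes and an honest archimedean place**, with
`mono`, `image_adm`, `image_fin`, `hul_nonempty`, `theta_nonempty` DISCHARGED: it remains to supply admissibility of
the (Ind3)-enlarged Θ-region at the labels `j ∈ 𝔽_l^⋇` (at a prime: a direct product over the summands of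
positive-finite-measure sets; AT `∞`: positive finite volume in `⊕_{(w,ε)} ℂ`, e.g. the Step (vii) container —
`Real.adm_thetaContainer_arch`) with finitely supported log-volume, and `ThetaFinite`.
[claim: Mochizuki2012, status: disputed] -/
theorem bridgeHyps_settingDHVolArch
    (hθ : ∀ (i : Fin (thetaIndex X).lstar) (vQ : (thetaIndex X).VQ),
      ((situationDHVolArch X hlog hc M archPk archSub Ψ act Mmod region).D n).Adm _ vQ
        ((settingDHVolArch X hlog hc M archPk archSub Ψ act Mmod region n lat sig split qData thetaBox qCentre hq
          hfin).thetaRegion3 (Setting.labelSucc i) vQ))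
    (hfinθ : ∀ i : Fin (thetaIndex X).lstar, (Function.support fun vQ : (thetaIndex X).VQ =>
      ((situationDHVolArch X hlog hc M archPk archSub Ψ act Mmod region).D n).logvol _ vQ
        ((settingDHVolArch X hlog hc M archPk archSub Ψ act Mmod region n lat sig split qData thetaBox qCentre hq
          hfin).thetaRegion3 (Setting.labelSucc i) vQ)).Finite)
    (finite : (settingDHVolArch X hlog hc M archPk archSub Ψ act Mmod region n lat sig split qData thetaBox qCentre
      hq hfin).ThetaFinite) :
    BridgeHyps (settingDHVolArch X hlog hc M archPk archSub Ψ act Mmod region n lat sig split qData thetaBox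
      qCentre hq hfin) :=
  bridgeHyps_DHArch X hlog hc M archPk archSub Ψ act Mmod region _ hθ hfinθ
    (hul_nonempty_settingDHVolArch X hlog hc M archPk archSub Ψ act Mmod region n lat sig split qData thetaBox
      qCentre hq hfin) finite

end Setting

end Real

end Thm311

end IUTFork

end Summit.ABC

end
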